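import Literature.IUT.HodgeArakelov.AbsTopMonoidsGenuineGhatHilbert90
import Literature.IUT.HodgeArakelov.AbsTopMonoidsGenuineProfiniteGroupifications
import Literature.AnabelianGeometry.EtaleTheta.ZHatLevelDetermination
import Mathlib.RingTheory.RootsOfUnity.AlgebraicallyClosed
import HarnessLib

/-!
# [IUTchII] Example 1.8 (vii) `(∗ĝp)` GENUINE, part 7: the `G_k`-action of `O^ĝp(G)` on normal levels, invariants in the
# direct limit, and the `Ẑ^×`-exponents of an EQUIVARIANT automorphism on the torsion `η(μ(k̄))`

S. Mochizuki, *Inter-universal Teichmüller theory II*, §1, Example 1.8 (vii) p. 40, Remark 1.11.1 (i) (c) p. 50 (proof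
"involving the Kummer map", [AbsTopIII] Prop. 3.3 (ii)) [claim: Mochizuki2012, status: disputed] (IUTchII §1 Rmk 1.11.1 (i),
kurims p.50).  abc-iut cell, layer L6, row «GHATGP-GENUINE» STAGE 3d-α (seat abc-iut-L6-d2 gen 6; post-freeze def, reading (ii):
bookkeeping defs `zetaU`, `torsionExpOf`, `levelFamilyOf`, `zhatOf`, `corrected`).

* `galActOghat_ofLevel_normal` / `galActOghat_ofLevel_of_mem` — on an open NORMAL level `N`, `σ` acts through
  `galLevel N σ`, and `N` acts trivially;
* `exists_ofLevel_eq_of_forall_galAct` — the `N`-invariants of `O^ĝp` come from the level `N` (profinite Hilbert 90,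
  `exists_levelMap_eq_of_invariant`, read in the direct limit); `eq_one_of_forall_exists_invariant_pow` — an element with
  `N`-invariant `m`-th roots for all `m` is `1`;
* `zhatPowOghat_toOghat_of_pow_eq_one` — `u ∈ Ẑ^×` acts on `η(ζ)`, `ζⁿ = 1`, by `ζ ↦ ζ^{χ_n(u)}`;
* for an automorphism `ψ` of `O^ĝp`: `zetaU` (primitive roots, `HasEnoughRootsOfUnity` of the algebraically closed `k̄`),
  `torsionExpOf ψ n` with `apply_toOghat_of_pow_eq_one` (`ψ(η ξ) = η(ξ^{a_n})` on `μ_n`), `torsionExpOf_mul_symm`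
  (`a_n(ψ) a_n(ψ⁻¹) = 1` in `ℤ/n`), `torsionExpOf_compat`, `levelFamilyOf`, **`zhatOf ψ ∈ Ẑ^×`** (abc-iut-L2's
  `ZHatLevel.autOfLevelFamily`), `apply_toOghat_torsion_eq` (`ψ = u(ψ)` on the torsion), `corrected ψ := u(ψ)⁻¹ ∘ ψ`
  (`corrected_comm`, `corrected_toOghat_torsion`), `ofLevel_of`.

Sequel `GaloisPairRigidityRmk1111cGenuine.lean`: the Kummer core and `Rmk1111_c` at the genuine `(∗ĝp)`.
HONEST FRAMING: classical algebra over OUR typed objects; nothing here bears on [IUTchIII] Cor. 3.12; typed ≠ proved elsewhere.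
-/

set_option autoImplicit false

noncomputable section

namespace Literature.IUT.HodgeArakelov

open CategoryTheory
open Literature.AnabelianGeometry.AbsoluteAnabelian

namespace AbsTopMonoids.Genuine

variable (C : MLFClosure.{0})

/-! ## The `G_k`-action on `O^ĝp` read on a NORMAL level -/

/-- On a normal open level `N`, `σ ∈ Gal(k̄/k)` acts on `ofLevel_N(w)` through the levelwise action `galLevel N σ`.
[claim: Mochizuki2012, status: disputed] (IUTchII §1 Ex 1.8 (vii), kurims p.40) -/
theorem galActOghat_ofLevel_normal (N : OpenSubgroup (C.K ≃ₐ[C.k] C.K)) [hN : (N : Subgroup (C.K ≃ₐ[C.k] C.K)).Normal]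
    (σ : C.K ≃ₐ[C.k] C.K) (w : levelGroup C ⟨N⟩) :
    galActOghat C σ (ofLevel C ⟨N⟩ w) = ofLevel C ⟨N⟩ (PowCompletion.map (galLevel C N σ) w) := by
  rw [galActOghat_apply, transportOghat_ofLevel]
  have hle : GhatLevel.transport C (conjAut C σ) ⟨N⟩ ≤ (⟨N⟩ : GhatLevel C) := by
    intro τ hτ
    rw [GhatLevel.mem_transport_iff]
    change (MulAut.conj σ).symm τ ∈ (N : Subgroup (C.K ≃ₐ[C.k] C.K))
    rw [MulAut.conj_symm_apply]
    simpa using hN.conj_mem τ hτ σ⁻¹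
  rw [← ofLevel_levelMap C hle]
  congr 1
  change PowCompletion.map _ (PowCompletion.map _ w) = _
  rw [← MonoidHom.comp_apply, ← PowCompletion.map_comp]
  exact congrFun (congrArg DFunLike.coe (PowCompletion.map_congr fun a => Subtype.ext rfl)) w

/-- Elements of `N` fix the level-`N` part of `O^ĝp`. [claim: Mochizuki2012, status: disputed] (IUTchII §1 Ex 1.8 (vii), kurims p.40) -/
theorem galActOghat_ofLevel_of_mem (N : OpenSubgroup (C.K ≃ₐ[C.k] C.K)) [(N : Subgroup (C.K ≃ₐ[C.k] C.K)).Normal]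
    (σ : C.K ≃ₐ[C.k] C.K) (hσ : σ ∈ (N : Subgroup (C.K ≃ₐ[C.k] C.K))) (w : levelGroup C ⟨N⟩) :
    galActOghat C σ (ofLevel C ⟨N⟩ w) = ofLevel C ⟨N⟩ w := by
  rw [galActOghat_ofLevel_normal]
  have : PowCompletion.map (galLevel C N σ) = MonoidHom.id _ := by
    rw [← PowCompletion.map_id]
    exact PowCompletion.map_congr fun a => galLevel_eq_self_of_mem C N σ hσ a
  rw [this, MonoidHom.id_apply]

/-- **`N`-invariants of `O^ĝp` come from the level `N`** (`N ⊴ Gal(k̄/k)` open): profinite Hilbert 90 read in the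
direct limit. [claim: Mochizuki2012, status: disputed] (IUTchII §1 Ex 1.8 (vii), kurims p.40) -/
theorem exists_ofLevel_eq_of_forall_galAct (N : OpenSubgroup (C.K ≃ₐ[C.k] C.K))
    [(N : Subgroup (C.K ≃ₐ[C.k] C.K)).Normal] (t : Oghat C)
    (ht : ∀ σ : C.K ≃ₐ[C.k] C.K, σ ∈ (N : Subgroup (C.K ≃ₐ[C.k] C.K)) → galActOghat C σ t = t) :
    ∃ y : levelGroup C ⟨N⟩, ofLevel C ⟨N⟩ y = t := by
  induction t using DirectLimit.induction with
  | ih i x =>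
    -- refine the level of `t` to an open normal `N' ⊆ i.J ∩ N`
    obtain ⟨N', hN'le, hN'n⟩ := exists_openNormal_le C (i.J ⊓ N)
    haveI := hN'n
    have hiN' : i ≤ (⟨N'⟩ : GhatLevel C) := fun τ hτ => (OpenSubgroup.mem_inf.mp (hN'le hτ)).1
    have hNN' : (N' : Subgroup (C.K ≃ₐ[C.k] C.K)) ≤ N := fun τ hτ => (OpenSubgroup.mem_inf.mp (hN'le hτ)).2
    set x' := levelMap C i ⟨N'⟩ hiN' x with hx'
    have ht' : (⟦⟨i, x⟩⟧ : Oghat C) = ofLevel C ⟨N'⟩ x' := by rw [hx', ofLevel_levelMap]; rfl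
    have hinv : ∀ σ : C.K ≃ₐ[C.k] C.K, σ ∈ (N : Subgroup (C.K ≃ₐ[C.k] C.K)) →
        PowCompletion.map (galLevel C N' σ) x' = x' := by
      intro σ hσ
      apply ofLevel_injective C ⟨N'⟩
      rw [← galActOghat_ofLevel_normal, ← ht']
      exact ht σ hσ
    obtain ⟨y, hy⟩ := exists_levelMap_eq_of_invariant C N N' hNN' x' hinv
    refine ⟨y, ?_⟩
    rw [ht', ← hy, ofLevel_levelMap]

/-- An element of `O^ĝp` admitting, for every `m`, an `N`-INVARIANT `m`-th root is trivial (it lies in the level `N`, where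
`⋂_m (—)^m = 1`). [claim: Mochizuki2012, status: disputed] (IUTchII §1 Ex 1.8 (vii), kurims p.40) -/
theorem eq_one_of_forall_exists_invariant_pow (N : OpenSubgroup (C.K ≃ₐ[C.k] C.K))
    [(N : Subgroup (C.K ≃ₐ[C.k] C.K)).Normal] (r : Oghat C)
    (hr : ∀ m : ℕ+, ∃ t : Oghat C,
      (∀ σ : C.K ≃ₐ[C.k] C.K, σ ∈ (N : Subgroup (C.K ≃ₐ[C.k] C.K)) → galActOghat C σ t = t) ∧ t ^ (m : ℕ) = r) :
    r = 1 := by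
  obtain ⟨t₁, ht₁, ht₁r⟩ := hr 1
  rw [PNat.one_coe, pow_one] at ht₁r
  subst ht₁r
  obtain ⟨ρ, hρ⟩ := exists_ofLevel_eq_of_forall_galAct C N t₁ ht₁
  rw [← hρ, ← map_one (ofLevel C ⟨N⟩)]
  congr 1
  refine PowCompletion.eq_one_of_forall_exists_pow ρ fun m => ?_
  obtain ⟨t, ht, htr⟩ := hr m
  obtain ⟨s, hs⟩ := exists_ofLevel_eq_of_forall_galAct C N t ht
  refine ⟨s, ofLevel_injective C ⟨N⟩ ?_⟩
  rw [map_pow, hs, htr, hρ]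

/-! ## The `Ẑ^×`-action on the torsion of `O^ĝp` -/

open PowCompletion in
/-- `u ∈ Ẑ^×` acts on `η(ζ)`, `ζⁿ = 1`, by `ζ ↦ ζ^{χ_n(u)}`. [claim: Mochizuki2012, status: disputed] (IUTchII §1 Ex 1.8 (vii), kurims p.40) -/
theorem zhatPowOghat_toOghat_of_pow_eq_one (u : ZHatUnits) {n : ℕ+} (ζ : (C.K)ˣ) (hζ : ζ ^ (n : ℕ) = 1) :
    zhatPowOghat C u (toOghat C ζ) = toOghat C (ζ ^ levelExp u n) := by
  have hmem := mem_fixedUnits_levelOf C ζ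
  have hmem' : ζ ^ levelExp u n ∈ fixedUnits C ((levelOf C ζ).J : Subgroup (C.K ≃ₐ[C.k] C.K)) :=
    Subgroup.pow_mem _ hmem _
  rw [toOghat_eq_ofLevel C ζ (levelOf C ζ) hmem, toOghat_eq_ofLevel C _ (levelOf C ζ) hmem', zhatPowOghat_ofLevel]
  congr 1
  -- in the level group: `u · η(ζ') = η(ζ'^{χ_n(u)})` for the `n`-torsion element `ζ'`
  set ζ' : fixedUnits C ((levelOf C ζ).J : Subgroup (C.K ≃ₐ[C.k] C.K)) := ⟨ζ, hmem⟩ with hζ'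
  have hζ'n : ζ' ^ (n : ℕ) = 1 := Subtype.ext hζ
  have hpow : (⟨ζ ^ levelExp u n, hmem'⟩ : fixedUnits C ((levelOf C ζ).J : Subgroup (C.K ≃ₐ[C.k] C.K))) =
      ζ' ^ levelExp u n := Subtype.ext rfl
  rw [hpow, map_pow]
  refine PowCompletion.ext fun m => ?_
  rw [← component_compat _ m (n * m) (dvd_mul_left _ _), ← component_compat (of _ ζ' ^ levelExp u n) m (n * m) (dvd_mul_left _ _),
    component_zhatPow_of, map_pow, component_of, ← QuotientGroup.mk_pow]
  congr 2
  exact pow_eq_pow_of_modEq hζ'n (levelExp_modEq u n (n * m) n.pos (n * m).pos (dvd_mul_right _ _))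

end AbsTopMonoids.Genuine


namespace AbsTopMonoids.Genuine

variable (C : MLFClosure.{0})

/-- Cancellation in a commutative group: `(u a)(u b)⁻¹ = a b⁻¹`. [cite: NeukirchANT1999, Ch. IV §2 p.274] -/
theorem mul_mul_inv_mul_inv {G : Type*} [CommGroup G] (u a b : G) : (u * a) * (u * b)⁻¹ = a * b⁻¹ := by
  rw [mul_inv_rev, mul_comm u a, mul_assoc, ← mul_assoc u, mul_comm u b⁻¹, mul_assoc, mul_inv_cancel, mul_one]

/-- `(a^m u)(b^m u)⁻¹ = (a b⁻¹)^m` in a commutative group. [cite: NeukirchANT1999, Ch. IV §2 p.274] -/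
theorem pow_mul_mul_pow_mul_inv {G : Type*} [CommGroup G] (u a b : G) (m : ℕ) :
    (a ^ m * u) * (b ^ m * u)⁻¹ = (a * b⁻¹) ^ m := by
  rw [mul_comm (a ^ m), mul_comm (b ^ m), mul_mul_inv_mul_inv, mul_pow, inv_pow]

/-- `(a b⁻¹)^m = a^m (b^m)⁻¹`. [cite: NeukirchANT1999, Ch. IV §2 p.274] -/
theorem mul_inv_pow' {G : Type*} [CommGroup G] (a b : G) (m : ℕ) : (a * b⁻¹) ^ m = a ^ m * (b ^ m)⁻¹ := by
  rw [mul_pow, inv_pow]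

/-! ## The kernel of `Aut(G ↷ O^ĝp(G)) → Aut(G)`: equivariant automorphisms of `O^ĝp` are `Ẑ^×`-powers -/

section Kernel

variable (ψ : Oghat C ≃* Oghat C)
  (hψ : ∀ (σ : C.K ≃ₐ[C.k] C.K) (z : Oghat C), ψ (galActOghat C σ z) = galActOghat C σ (ψ z))

/-- A chosen primitive `n`-th root of unity of `k̄` (algebraically closed of characteristic `0`), as a unit.
[claim: Mochizuki2012, status: disputed] (IUTchII §1 Rmk 1.11.1 (i), kurims p.50) -/
def zetaU (n : ℕ+) : (C.K)ˣ :=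
  haveI : IsAlgClosed C.K := IsAlgClosure.isAlgClosed C.k
  haveI : CharZero C.K := C.charZero_K
  haveI : NeZero ((n : ℕ) : C.K) := ⟨Nat.cast_ne_zero.mpr n.ne_zero⟩
  Units.mk0 (HasEnoughRootsOfUnity.exists_primitiveRoot C.K n).choose
    ((HasEnoughRootsOfUnity.exists_primitiveRoot C.K n).choose_spec.ne_zero n.ne_zero)

/-- `isPrimitiveRoot_zetaU` (step of the kernel computation for the genuine `(∗ĝp)`). [claim: Mochizuki2012, status: disputed] (IUTchII §1 Rmk 1.11.1 (i), kurims p.50) -/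
theorem isPrimitiveRoot_zetaU (n : ℕ+) : IsPrimitiveRoot (zetaU C n) n := by
  haveI : IsAlgClosed C.K := IsAlgClosure.isAlgClosed C.k
  haveI : CharZero C.K := C.charZero_K
  haveI : NeZero ((n : ℕ) : C.K) := ⟨Nat.cast_ne_zero.mpr n.ne_zero⟩
  rw [← IsPrimitiveRoot.coe_units_iff]
  unfold zetaU
  rw [Units.val_mk0]
  exact (HasEnoughRootsOfUnity.exists_primitiveRoot C.K n).choose_spec

/-- Every `n`-th root of unity is a power of `ζ_n`. [claim: Mochizuki2012, status: disputed] (IUTchII §1 Rmk 1.11.1 (i), kurims p.50) -/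
theorem exists_zetaU_pow_eq {n : ℕ+} (ξ : (C.K)ˣ) (hξ : ξ ^ (n : ℕ) = 1) : ∃ i : ℕ, zetaU C n ^ i = ξ := by
  haveI : NeZero (n : ℕ) := ⟨n.ne_zero⟩
  have hξ' : ((ξ : (C.K)ˣ) : C.K) ^ (n : ℕ) = 1 := by rw [← Units.val_pow_eq_pow_val, hξ, Units.val_one]
  obtain ⟨i, -, hi⟩ := ((IsPrimitiveRoot.coe_units_iff).mpr (isPrimitiveRoot_zetaU C n)).eq_pow_of_pow_eq_one hξ'
  exact ⟨i, Units.ext (by rw [Units.val_pow_eq_pow_val, hi])⟩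

/-- `zetaU_pow` (step of the kernel computation for the genuine `(∗ĝp)`). [claim: Mochizuki2012, status: disputed] (IUTchII §1 Rmk 1.11.1 (i), kurims p.50) -/
theorem zetaU_pow (n : ℕ+) : zetaU C n ^ (n : ℕ) = 1 := (isPrimitiveRoot_zetaU C n).pow_eq_one

include ψ in
/-- `ψ(η(ζ_n))` is again an `n`-th root of unity: `= η(ζ_n^a)` for some `a`. [claim: Mochizuki2012, status: disputed] (IUTchII §1 Rmk 1.11.1 (i), kurims p.50) -/
theorem exists_apply_toOghat_zetaU (n : ℕ+) : ∃ a : ℕ, ψ (toOghat C (zetaU C n)) = toOghat C (zetaU C n ^ a) := by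
  have htors : (ψ (toOghat C (zetaU C n))) ^ (n : ℕ) = 1 := by
    rw [← map_pow ψ, ← map_pow (toOghat C), zetaU_pow, map_one, map_one]
  obtain ⟨ξ, hξ, hψξ⟩ := exists_eq_toOghat_of_pow_eq_one C _ htors
  obtain ⟨i, hi⟩ := exists_zetaU_pow_eq C ξ hξ
  exact ⟨i, by rw [hψξ, hi]⟩

/-- The exponent `a_n(ψ)` with `ψ(η ζ) = η(ζ^{a_n})` on `μ_n`. [claim: Mochizuki2012, status: disputed] (IUTchII §1 Rmk 1.11.1 (i), kurims p.50) -/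
def torsionExpOf (n : ℕ+) : ℕ := (exists_apply_toOghat_zetaU C ψ n).choose

/-- `torsionExpOf_spec` (step of the kernel computation for the genuine `(∗ĝp)`). [claim: Mochizuki2012, status: disputed] (IUTchII §1 Rmk 1.11.1 (i), kurims p.50) -/
theorem torsionExpOf_spec (n : ℕ+) :
    ψ (toOghat C (zetaU C n)) = toOghat C (zetaU C n ^ torsionExpOf C ψ n) :=
  (exists_apply_toOghat_zetaU C ψ n).choose_spec

/-- `ψ(η ξ) = η(ξ^{a_n})` for EVERY `n`-th root of unity `ξ`. [claim: Mochizuki2012, status: disputed] (IUTchII §1 Rmk 1.11.1 (i), kurims p.50) -/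
theorem apply_toOghat_of_pow_eq_one {n : ℕ+} (ξ : (C.K)ˣ) (hξ : ξ ^ (n : ℕ) = 1) :
    ψ (toOghat C ξ) = toOghat C (ξ ^ torsionExpOf C ψ n) := by
  obtain ⟨j, rfl⟩ := exists_zetaU_pow_eq C ξ hξ
  rw [map_pow (toOghat C), map_pow ψ, torsionExpOf_spec, ← map_pow (toOghat C), ← pow_mul, ← pow_mul, mul_comm]

include hψ in
/-- `ψ⁻¹` is equivariant too. [claim: Mochizuki2012, status: disputed] (IUTchII §1 Rmk 1.11.1 (i), kurims p.50) -/
theorem symm_comm (σ : C.K ≃ₐ[C.k] C.K) (z : Oghat C) : ψ.symm (galActOghat C σ z) = galActOghat C σ (ψ.symm z) := by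
  apply ψ.injective
  rw [MulEquiv.apply_symm_apply, hψ, MulEquiv.apply_symm_apply]

/-- `a_n(ψ) · a_n(ψ⁻¹) ≡ 1 (mod n)`. [claim: Mochizuki2012, status: disputed] (IUTchII §1 Rmk 1.11.1 (i), kurims p.50) -/
theorem torsionExpOf_mul_symm (n : ℕ+) :
    ((torsionExpOf C ψ n : ZMod n)) * (torsionExpOf C ψ.symm n : ZMod n) = 1 := by
  have h := apply_toOghat_of_pow_eq_one C ψ.symm (zetaU C n) (zetaU_pow C n)
  have h2 : toOghat C (zetaU C n) = toOghat C ((zetaU C n ^ torsionExpOf C ψ.symm n) ^ torsionExpOf C ψ n) := by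
    have := congrArg ψ h
    rw [MulEquiv.apply_symm_apply, apply_toOghat_of_pow_eq_one C ψ _ (by rw [← pow_mul, mul_comm, pow_mul, zetaU_pow, one_pow])] at this
    exact this
  have h3 := toOghat_injective C h2
  rw [← pow_mul] at h3
  have h4 : 1 ≡ torsionExpOf C ψ.symm n * torsionExpOf C ψ n [MOD (n : ℕ)] := by
    rw [(isPrimitiveRoot_zetaU C n).eq_orderOf, ← pow_eq_pow_iff_modEq, pow_one]
    exact h3
  rw [← Nat.cast_mul, mul_comm, ← Nat.cast_one, ZMod.natCast_eq_natCast_iff]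
  exact h4.symm

/-- The exponents are COMPATIBLE: `a_N ≡ a_n (mod n)` for `n ∣ N`. [claim: Mochizuki2012, status: disputed] (IUTchII §1 Rmk 1.11.1 (i), kurims p.50) -/
theorem torsionExpOf_compat (n N : ℕ+) (h : (n : ℕ) ∣ N) :
    ZMod.castHom h (ZMod n) (torsionExpOf C ψ N : ZMod N) = (torsionExpOf C ψ n : ZMod n) := by
  obtain ⟨m, hm⟩ := h
  -- `ξ := ζ_N^m` is a primitive `n`-th root of unity
  have hξ : IsPrimitiveRoot (zetaU C N ^ m) n :=
    (isPrimitiveRoot_zetaU C N).pow N.pos (by rw [hm, mul_comm])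
  have hξn : (zetaU C N ^ m) ^ (n : ℕ) = 1 := hξ.pow_eq_one
  have hξN : (zetaU C N ^ m) ^ (N : ℕ) = 1 := by rw [← pow_mul, mul_comm, pow_mul, zetaU_pow, one_pow]
  have h1 := apply_toOghat_of_pow_eq_one C ψ _ hξn
  rw [apply_toOghat_of_pow_eq_one C ψ _ hξN] at h1
  have h2 := toOghat_injective C h1
  have h3 : torsionExpOf C ψ N ≡ torsionExpOf C ψ n [MOD (n : ℕ)] := by
    rw [hξ.eq_orderOf, ← pow_eq_pow_iff_modEq]
    exact h2
  rw [map_natCast]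
  exact (ZMod.natCast_eq_natCast_iff _ _ _).mpr h3

/-- The compatible family `(a_n(ψ))_n`. [claim: Mochizuki2012, status: disputed] (IUTchII §1 Rmk 1.11.1 (i), kurims p.50) -/
def levelFamilyOf : Literature.AnabelianGeometry.EtaleTheta.ZHatLevel.LevelFamily where
  c n := (torsionExpOf C ψ n : ZMod n)
  compat n N h := torsionExpOf_compat C ψ n N h

/-- **THE `u(ψ) ∈ Ẑ^×`** whose cyclotomic characters are the exponents of `ψ` on the torsion (surjectivity of
`Aut(Ẑ) → lim (ℤ/n)^×`, abc-iut-L2's `ZHatLevel.autOfLevelFamily`). [claim: Mochizuki2012, status: disputed] (IUTchII §1 Rmk 1.11.1 (i), kurims p.50) -/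
def zhatOf : ZHatUnits :=
  Literature.AnabelianGeometry.EtaleTheta.ZHatLevel.autOfLevelFamily (levelFamilyOf C ψ) (levelFamilyOf C ψ.symm)
    fun n => torsionExpOf_mul_symm C ψ n

/-- `levelExp_zhatOf` (step of the kernel computation for the genuine `(∗ĝp)`). [claim: Mochizuki2012, status: disputed] (IUTchII §1 Rmk 1.11.1 (i), kurims p.50) -/
theorem levelExp_zhatOf (n : ℕ+) : levelExp (zhatOf C ψ) n = torsionExpOf C ψ n % (n : ℕ) := by
  rw [levelExp_of_pos _ n.pos]
  change (Literature.AnabelianGeometry.EtaleTheta.ZHatLevel.levelChar n (zhatOf C ψ)).val = _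
  rw [zhatOf, Literature.AnabelianGeometry.EtaleTheta.ZHatLevel.levelChar_autOfLevelFamily]
  exact ZMod.val_natCast _ _

/-- `ψ` and `u(ψ)` agree on the torsion `η(μ(k̄))`. [claim: Mochizuki2012, status: disputed] (IUTchII §1 Rmk 1.11.1 (i), kurims p.50) -/
theorem apply_toOghat_torsion_eq (ξ : (C.K)ˣ) {n : ℕ+} (hξ : ξ ^ (n : ℕ) = 1) :
    ψ (toOghat C ξ) = zhatPowOghat C (zhatOf C ψ) (toOghat C ξ) := by
  rw [apply_toOghat_of_pow_eq_one C ψ ξ hξ, zhatPowOghat_toOghat_of_pow_eq_one C _ ξ hξ, levelExp_zhatOf]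
  congr 1
  exact PowCompletion.pow_eq_pow_of_modEq hξ (Nat.mod_modEq _ _).symm

/-- The corrected automorphism `ψ' := u(ψ)⁻¹ ∘ ψ`. [claim: Mochizuki2012, status: disputed] (IUTchII §1 Rmk 1.11.1 (i), kurims p.50) -/
def corrected : Oghat C ≃* Oghat C := ψ.trans (zhatPowOghat C (zhatOf C ψ)).symm

/-- `corrected_apply` (step of the kernel computation for the genuine `(∗ĝp)`). [claim: Mochizuki2012, status: disputed] (IUTchII §1 Rmk 1.11.1 (i), kurims p.50) -/
theorem corrected_apply (z : Oghat C) : corrected C ψ z = (zhatPowOghat C (zhatOf C ψ)).symm (ψ z) := rfl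

set_option maxHeartbeats 400000 in
include hψ in
/-- `corrected_comm` (step of the kernel computation for the genuine `(∗ĝp)`). [claim: Mochizuki2012, status: disputed] (IUTchII §1 Rmk 1.11.1 (i), kurims p.50) -/
theorem corrected_comm (σ : C.K ≃ₐ[C.k] C.K) (z : Oghat C) :
    corrected C ψ (galActOghat C σ z) = galActOghat C σ (corrected C ψ z) := by
  rw [corrected_apply, corrected_apply, hψ]
  apply (zhatPowOghat C (zhatOf C ψ)).injective
  rw [MulEquiv.apply_symm_apply, ← galActOghat_zhatPowOghat, MulEquiv.apply_symm_apply]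

/-- `corrected_toOghat_torsion` (step of the kernel computation for the genuine `(∗ĝp)`). [claim: Mochizuki2012, status: disputed] (IUTchII §1 Rmk 1.11.1 (i), kurims p.50) -/
theorem corrected_toOghat_torsion (ξ : (C.K)ˣ) {n : ℕ+} (hξ : ξ ^ (n : ℕ) = 1) :
    corrected C ψ (toOghat C ξ) = toOghat C ξ := by
  rw [corrected_apply, apply_toOghat_torsion_eq C ψ ξ hξ, MulEquiv.symm_apply_apply]

/-- `ofLevel_J (η_J a) = η a`. [claim: Mochizuki2012, status: disputed] (IUTchII §1 Ex 1.8 (vii), kurims p.40) -/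
theorem ofLevel_of (i : GhatLevel C) (a : fixedUnits C (i.J : Subgroup (C.K ≃ₐ[C.k] C.K))) :
    ofLevel C i (PowCompletion.of _ a) = toOghat C (a : (C.K)ˣ) :=
  (toOghat_eq_ofLevel C (a : (C.K)ˣ) i a.2).symm

end Kernel

end AbsTopMonoids.Genuine

end Literature.IUT.HodgeArakelov

end
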